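import Mathlib.NumberTheory.Chebyshev
import Literature.NumberTheory.LFunctions.NicolasPsiTheta
import Literature.NumberTheory.LFunctions.LogIntegral
import HarnessLib

/-!
# Explicit bounds for `θ(x) − x`: Büthe 2018 (square-root bounds for `x ≤ 10¹⁹`) and
# Broadbent–Kadiri–Lumley–Ng–Wilk 2021 (relative bound for `x ≥ 10¹⁹`)

Topic: `Literature/NumberTheory/LFunctions`. Two published, unconditional, computer-assisted theorems
on Chebyshev's `θ`, vendored as NAMED FACTS exactly as printed (they are the hypotheses `(H2)`, `(H3)`
of the rh-explicit ROBIN calibration row B-ROBIN-CAL-24: Robin's inequality for all 24-free `n` from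
printed inputs; see `run/shared/lean/pub/rh-explicit/robin/STEP0-ROBIN-RESULT.md` §R), plus the
elementary consequences the tree can prove from them.

* `Buthe2018_thm2_theta` — J. Büthe, *An analytic method for bounding ψ(x)*, Math. Comp. 87 (2018)
  1991–2009, **Theorem 2**, the two `ϑ`-lines: `x − ϑ(x) ≤ 1.95 √x` for `1423 ≤ x ≤ 10¹⁹` and
  `x − ϑ(x) > 0.05 √x` for `1 ≤ x ≤ 10¹⁹` (from explicit-formula computations with the zeros of `ζ`
  of imaginary part up to `10¹¹`; "the calculations took about 1,200 hours").
  `Buthe2018_thm2_psi` — the `ψ`-line `|x − ψ(x)| ≤ 0.94 √x` for `11 < x ≤ 10¹⁹`;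
  `Buthe2018_thm2_li_sub_pi` — the two `π`-lines `li(x) − π(x) ≤ (√x/log x)(1.95 + 3.9/log x + 19.5/log² x)`
  and `li(x) − π(x) > 0` for `2 ≤ x ≤ 10¹⁹` ("a new lower bound for the Skewes number"), with
  `li = Literature.NumberTheory.LFunctions.logIntegral` (principal value from `0`; the source's `li`, as its
  §7 value at `a = 10` confirms — `li(10) = 6.1656…`; added 2026-08-27, gen 7 of the RH literature-typing
  tranche). (The remaining line `|li(x) − π*(x)| < √x/log x`, `π*(x) = Σ_k π(x^{1/k})/k`, is not typed:
  no `π*` in the tree; TODO(general form).)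
* `BroadbentEtAl2021_theta_rel_1e19` — S. Broadbent, H. Kadiri, A. Lumley, N. Ng, K. Wilk, *Sharper
  bounds for the Chebyshev function θ(x)*, Math. Comp. 90 (2021) 2281–2315, §1.2 (the `k = 2` instance
  of their Theorem 1 / tables): for all `x ≥ 10¹⁹`, `|θ(x) − x|/x < 3.79·10⁻⁵/(log x)²`.

Proved here (no new hypotheses): `Buthe2018_thm2_psi.abs_sub_le`, `Buthe2018_thm2_li_sub_pi.primeCounting_lt_logIntegral`
(`π(x) < li(x)` on `[2, 10¹⁹]`), `Buthe2018_thm2_theta.theta_lt` (`θ(x) < x` on `[1, 10¹⁹]`),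
`Buthe2018_thm2_theta.abs_sub_le` (`|θ(x) − x| ≤ 1.95 √x` on `[1423, 10¹⁹]`),
`Buthe2018_thm2_theta.plattTrudgian2016_theta_lt` (Büthe's third line contains the tree's named fact
`PlattTrudgian2016_theta_lt`, "`θ(x) < x` for `0 < x ≤ 1.39·10¹⁷`", so a user holding Büthe's theorem
needs no separate Platt–Trudgian hypothesis), and `BroadbentEtAl2021_theta_rel_1e19.abs_sub_lt`
(the bound in the multiplied-out form `|θ(x) − x| < 3.79·10⁻⁵ · x/(log x)²`).

As-printed notes. Büthe's Theorem 2 is typed from the arXiv text (1511.02032, final version,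
`[corpus:paper:arxiv-1511.02032 p0003:L42–51]`); the journal page check is pending (acq-09975). In
BKLNW's arXiv text (2002.11068, `[corpus:paper:arxiv-2002.11068 p0003:L140–p0004:L2]`) the display
reads "for all `x ≥ 10¹⁹`, `1.9338·10⁻⁸ < (θ(x)−x)/x < 1.9667·10⁻⁸` and `|(θ(x)−x)/x| < 3.79·10⁻⁵/(log x)²`";
the first (`k = 0`) line is mis-ordered as printed (their Theorem 1 gives `−m₀ ≤ (θ(x)−x)/x ≤ M₀` with
`M₀ = 1.93378·10⁻⁸`, Corollary 1) and is NOT typed; only the `k = 2` line is (journal check pending,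
acq-09971). Nothing here is asserted: the facts are `def … : Prop`; users take them as hypotheses.

## References

* [Buthe2018] J. Büthe, Math. Comp. 87 (2018), no. 312, 1991–2009, Thm. 2 (doi 10.1090/mcom/3264;
  arXiv:1511.02032).
* [BroadbentEtAl2021] S. Broadbent, H. Kadiri, A. Lumley, N. Ng, K. Wilk, Math. Comp. 90 (2021),
  no. 331, 2281–2315, §1.2 and Cor. 1 (doi 10.1090/mcom/3643; arXiv:2002.11068).
* [PlattTrudgian2016Theta] D. J. Platt, T. S. Trudgian, Math. Comp. 85 (2016), Thm. 1 (the tree's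
  `PlattTrudgian2016_theta_lt`, `NicolasPsiTheta.lean`).
-/

noncomputable section

open Real
open scoped Chebyshev

namespace Literature.NumberTheory.LFunctions

/-! ### The named facts -/

/-- NAMED FACT (Büthe 2018, Theorem 2, the `ϑ`-lines, as printed: "`x − ϑ(x) ≤ 1.95 √x` for
`1423 ≤ x ≤ 10¹⁹`" and "`x − ϑ(x) > 0.05 √x` for `1 ≤ x ≤ 10¹⁹`"). Unconditional (explicit formula with
the zeros of `ζ` up to height `10¹¹`). `θ = Chebyshev.theta`. Users take `(h : Buthe2018_thm2_theta)`.
[cite: Buthe2018, Thm. 2 (lines 2–3)] -/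
def Buthe2018_thm2_theta : Prop :=
  (∀ x : ℝ, 1423 ≤ x → x ≤ (10 : ℝ) ^ 19 → x - θ x ≤ 1.95 * Real.sqrt x) ∧
    (∀ x : ℝ, 1 ≤ x → x ≤ (10 : ℝ) ^ 19 → 0.05 * Real.sqrt x < x - θ x)

/-- NAMED FACT (Broadbent–Kadiri–Lumley–Ng–Wilk 2021, §1.2, the `k = 2` bound beyond Büthe's range, as
printed: "for all `x ≥ 10¹⁹` … `|(θ(x) − x)/x| < 3.79·10⁻⁵/(log x)²`"). Unconditional. `θ = Chebyshev.theta`.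
Users take `(h : BroadbentEtAl2021_theta_rel_1e19)`.
[cite: BroadbentEtAl2021, §1.2 (display after Thm. 1), k = 2, x ≥ 10^19] -/
def BroadbentEtAl2021_theta_rel_1e19 : Prop :=
  ∀ x : ℝ, (10 : ℝ) ^ 19 ≤ x → |(θ x - x) / x| < 3.79e-5 / Real.log x ^ 2

/-- NAMED FACT (Büthe 2018, Theorem 2, the `ψ`-line, as printed: "`|x − ψ(x)| ≤ 0.94 √x` for
`11 < x ≤ 10¹⁹`"). Unconditional (explicit formula with the zeros of `ζ` up to height `10¹¹`).
`ψ = Chebyshev.psi`. Users take `(h : Buthe2018_thm2_psi)`. [cite: Buthe2018, Thm. 2 (line 1)] -/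
def Buthe2018_thm2_psi : Prop :=
  ∀ x : ℝ, 11 < x → x ≤ (10 : ℝ) ^ 19 → |x - ψ x| ≤ 0.94 * Real.sqrt x

/-- NAMED FACT (Büthe 2018, Theorem 2, the `π`-lines, as printed:
"`li(x) − π(x) ≤ (√x/log(x))(1.95 + 3.9/log x + 19.5/log(x)²)` for `2 ≤ x ≤ 10¹⁹`" and
"`li(x) − π(x) > 0` for `2 ≤ x ≤ 10¹⁹`" — "a new lower bound for the Skewes number"). `li` is the
principal-value logarithmic integral `logIntegral` (`LogIntegral.lean`), `π(x) = Nat.primeCounting ⌊x⌋₊`.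
Unconditional (computer-assisted). Users take `(h : Buthe2018_thm2_li_sub_pi)`.
[cite: Buthe2018, Thm. 2 (lines 5–6)] -/
def Buthe2018_thm2_li_sub_pi : Prop :=
  ∀ x : ℝ, 2 ≤ x → x ≤ (10 : ℝ) ^ 19 →
    logIntegral x - (Nat.primeCounting ⌊x⌋₊ : ℝ) ≤
        Real.sqrt x / Real.log x * (1.95 + 3.9 / Real.log x + 19.5 / Real.log x ^ 2) ∧
      0 < logIntegral x - (Nat.primeCounting ⌊x⌋₊ : ℝ)

/-! ### Elementary consequences (proved) -/

namespace Buthe2018_thm2_psi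

/-- Two-sided form with the tree's orientation: `|ψ(x) − x| ≤ 0.94 √x` for `11 < x ≤ 10¹⁹`.
[cite: Buthe2018, Thm. 2 (line 1)] -/
theorem abs_sub_le (h : Buthe2018_thm2_psi) {x : ℝ} (hx : 11 < x) (h19 : x ≤ (10 : ℝ) ^ 19) :
    |ψ x - x| ≤ 0.94 * Real.sqrt x := by
  rw [abs_sub_comm]
  exact h x hx h19

end Buthe2018_thm2_psi

namespace Buthe2018_thm2_li_sub_pi

/-- **`π(x) < li(x)` for `2 ≤ x ≤ 10¹⁹`** (the Skewes number is `> 10¹⁹`).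
[cite: Buthe2018, Thm. 2 (line 6)] -/
theorem primeCounting_lt_logIntegral (h : Buthe2018_thm2_li_sub_pi) {x : ℝ} (h2 : 2 ≤ x)
    (h19 : x ≤ (10 : ℝ) ^ 19) : (Nat.primeCounting ⌊x⌋₊ : ℝ) < logIntegral x := by
  have := (h x h2 h19).2
  linarith

/-- Two-sided form: `0 < li(x) − π(x) ≤ (√x/log x)(1.95 + 3.9/log x + 19.5/log² x)` on `[2, 10¹⁹]`, hence
`|π(x) − li(x)| ≤ (√x/log x)(1.95 + 3.9/log x + 19.5/log² x)`. [cite: Buthe2018, Thm. 2 (lines 5–6)] -/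
theorem abs_sub_le (h : Buthe2018_thm2_li_sub_pi) {x : ℝ} (h2 : 2 ≤ x) (h19 : x ≤ (10 : ℝ) ^ 19) :
    |(Nat.primeCounting ⌊x⌋₊ : ℝ) - logIntegral x| ≤
      Real.sqrt x / Real.log x * (1.95 + 3.9 / Real.log x + 19.5 / Real.log x ^ 2) := by
  obtain ⟨hup, hpos⟩ := h x h2 h19
  rw [abs_sub_comm, abs_of_pos hpos]
  exact hup

end Buthe2018_thm2_li_sub_pi

namespace Buthe2018_thm2_theta

/-- From Büthe's third line: `θ(x) < x` for every real `1 ≤ x ≤ 10¹⁹`.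
[cite: Buthe2018, Thm. 2 (line 3)] -/
theorem theta_lt (h : Buthe2018_thm2_theta) {x : ℝ} (h1 : 1 ≤ x) (h19 : x ≤ (10 : ℝ) ^ 19) :
    θ x < x := by
  have hlow := h.2 x h1 h19
  have hs : 0 ≤ 0.05 * Real.sqrt x := mul_nonneg (by norm_num) (Real.sqrt_nonneg x)
  linarith

/-- Two-sided form on Büthe's common range: `|θ(x) − x| ≤ 1.95 √x` for `1423 ≤ x ≤ 10¹⁹`.
[cite: Buthe2018, Thm. 2 (lines 2–3)] -/
theorem abs_sub_le (h : Buthe2018_thm2_theta) {x : ℝ} (hx : 1423 ≤ x) (h19 : x ≤ (10 : ℝ) ^ 19) :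
    |θ x - x| ≤ 1.95 * Real.sqrt x := by
  have hup := h.1 x hx h19
  have hlow := h.2 x (by linarith) h19
  have hs : 0 ≤ 0.05 * Real.sqrt x := mul_nonneg (by norm_num) (Real.sqrt_nonneg x)
  rw [abs_sub_comm, abs_of_nonneg (by linarith)]
  exact hup

/-- Büthe's theorem contains the tree's named fact `PlattTrudgian2016_theta_lt` ("`θ(x) < x` for
`0 < x ≤ 1.39·10¹⁷`", Platt–Trudgian 2016, Thm. 1): below `1`, `θ` vanishes; on `[1, 1.39·10¹⁷]`
use `theta_lt`. [cite: Buthe2018, Thm. 2 (line 3); PlattTrudgian2016Theta, Thm. 1] -/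
theorem plattTrudgian2016_theta_lt (h : Buthe2018_thm2_theta) : PlattTrudgian2016_theta_lt := by
  intro x hx0 hx
  by_cases h1 : 1 ≤ x
  · exact h.theta_lt h1 (hx.trans (by norm_num))
  · rw [Chebyshev.theta_eq_zero_of_le_one (le_of_lt (not_le.mp h1))]
    exact hx0

end Buthe2018_thm2_theta

namespace BroadbentEtAl2021_theta_rel_1e19

/-- Multiplied-out form: `|θ(x) − x| < 3.79·10⁻⁵ · x/(log x)²` for `x ≥ 10¹⁹`.
[cite: BroadbentEtAl2021, §1.2, k = 2, x ≥ 10^19] -/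
theorem abs_sub_lt (h : BroadbentEtAl2021_theta_rel_1e19) {x : ℝ} (hx : (10 : ℝ) ^ 19 ≤ x) :
    |θ x - x| < 3.79e-5 * x / Real.log x ^ 2 := by
  have hx0 : 0 < x := lt_of_lt_of_le (by norm_num) hx
  have h' := h x hx
  rw [abs_div, abs_of_pos hx0, div_lt_iff₀ hx0] at h'
  have e : 3.79e-5 / Real.log x ^ 2 * x = 3.79e-5 * x / Real.log x ^ 2 := by ring
  rwa [e] at h'

end BroadbentEtAl2021_theta_rel_1e19

end Literature.NumberTheory.LFunctions

end
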